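import Summits.BirchSwinnertonDyer.BirchSwinnertonDyer.Theorems.SignedLowerHalvesSmallImageLowerHalfBothSignsRttE2KLambdaSocketGlue
import Literature.NumberTheory.EllipticCurves.IwasawaAlgebraDivisibilityProofs
import HarnessLib

/-!
# Route `SignedLowerHalves`, crux L `SmallImageLowerHalfBothSigns` (item stmt-BirchSwinnertonDyer-23599), line `rtt_w3` v13 — E2: `lambdaInvariant` is MONOTONE
# along surjections and injections of finitely generated torsion `Λ_𝒪 = IwasawaAlgebraO S`-modules (the glue's context)

Width seat `bsd-line-slh-p3-w3` g19 under LEAD `cruxlead-stmt-BirchSwinnertonDyer-23599` g9 (cell `bsd-ssimc`); ROUTE-INDEPENDENT helper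
(`--supports stmt-BirchSwinnertonDyer-23599`); THEOREMS ONLY — no definition, no named fact, no instance, no `sorry`; closes nothing; BSD is not proved
by any of this. Companion of `…RttE2KLambdaSocketLe` (p776193): same three-layer transport (carrier `PowerSeries (unitBall p E)` with propositional
compatibilities → `IwasawaAlgebraO S` with a pinned `ι₀` → the glue's `[Algebra Λ Λ_𝒪]`/`halg`/`[IsScalarTower Λ Λ_𝒪 ·]` context), engine
`Module.lengthAt_le_of_surjective` / `Module.lengthAt_le_of_injective` + RTT@2's `CharIdealLambda.finrank_baseChange_le_of_lengthAt_le`.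
USE (row D2): the glue's `H := Hsp ⧸ torsion` variant — `Hsp ⧸ Λ_𝒪∙z ↠ (Hsp⧸t) ⧸ Λ_𝒪∙z̄` gives `hK` for `Hsp ⧸ t` from `hK` for `Hsp`; and D2-seq's comparisons
`X' ↔ Dψ.X` through maps with one-sided control.

* §1 `lambdaInvariant_le_of_surjective` / `lambdaInvariant_le_of_injective` — carrier `PowerSeries (unitBall p E)`.
* §2 `…_iwasawaAlgebraO` — pinned `ι₀`.  §3 ★★ `lambdaInvariant_le_of_surjective_of_algebraMap_eq` / `lambdaInvariant_le_of_injective_of_algebraMap_eq` — glue context.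

References: [Washington1997] §13.2; [BourbakiAC5to7] VII §4.5, II §2.4.
-/

set_option autoImplicit false
-- the Theorems namespace of this sub repeats the summit name by design (D-0017 nested layout)
set_option linter.dupNamespace false

noncomputable section

open scoped TensorProduct
open Literature.NumberTheory.Automorphic Literature.NumberTheory.EllipticCurves

namespace Summit.BirchSwinnertonDyer.BirchSwinnertonDyer.Theorems.SmallImageRttE2Num

universe v v'

section UnitBall

variable (p : ℕ) [Fact p.Prime] (E : IntermediateField ℚ_[p] (PadicAlgCl p)) [FiniteDimensional ℚ_[p] E]

/-- **`λ` decreases along surjections**, carrier `𝒪⟦T⟧`, `𝒪 = unitBall p E`: for f.g. torsion `Λ_𝒪`-modules `M ↠ N` with compatible `𝒪`-, `ℤ_p`-,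
`Λ`-structures, `lambdaInvariant p N ≤ lambdaInvariant p M` (local lengths decrease; `λ` is the `ϖ`-free length sum). [cite: Washington1997, §13.2] -/
theorem lambdaInvariant_le_of_surjective (M : Type v) (N : Type v') [AddCommGroup M] [AddCommGroup N]
    [Module (PowerSeries (PadicIntermediateField.unitBall p E)) M] [Module (PowerSeries (PadicIntermediateField.unitBall p E)) N]
    [Module.Finite (PowerSeries (PadicIntermediateField.unitBall p E)) M] [Module.Finite (PowerSeries (PadicIntermediateField.unitBall p E)) N]
    (hM : Module.IsTorsion (PowerSeries (PadicIntermediateField.unitBall p E)) M)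
    (hN : Module.IsTorsion (PowerSeries (PadicIntermediateField.unitBall p E)) N)
    [Module (PadicIntermediateField.unitBall p E) M] [Module (PadicIntermediateField.unitBall p E) N]
    (h𝒪M : ∀ (a : PadicIntermediateField.unitBall p E) (m : M), (PowerSeries.C a) • m = a • m)
    (h𝒪N : ∀ (a : PadicIntermediateField.unitBall p E) (n : N), (PowerSeries.C a) • n = a • n)
    [Module ℤ_[p] M] [Module ℤ_[p] N]
    (hℤM : ∀ (r : ℤ_[p]) (m : M), (algebraMap ℤ_[p] (PadicIntermediateField.unitBall p E) r) • m = r • m)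
    (hℤN : ∀ (r : ℤ_[p]) (n : N), (algebraMap ℤ_[p] (PadicIntermediateField.unitBall p E) r) • n = r • n)
    [Module (IwasawaAlgebra p) M] [Module (IwasawaAlgebra p) N]
    (hΛM : ∀ (r : ℤ_[p]) (m : M), (PowerSeries.C r : IwasawaAlgebra p) • m = r • m)
    (hΛN : ∀ (r : ℤ_[p]) (n : N), (PowerSeries.C r : IwasawaAlgebra p) • n = r • n)
    (g : M →ₗ[PowerSeries (PadicIntermediateField.unitBall p E)] N) (hg : Function.Surjective g) :
    lambdaInvariant p N ≤ lambdaInvariant p M := by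
  haveI : IsScalarTower (PadicIntermediateField.unitBall p E) (PowerSeries (PadicIntermediateField.unitBall p E)) M :=
    IsScalarTower.of_algebraMap_smul h𝒪M
  haveI : IsScalarTower (PadicIntermediateField.unitBall p E) (PowerSeries (PadicIntermediateField.unitBall p E)) N :=
    IsScalarTower.of_algebraMap_smul h𝒪N
  haveI := LambdaLowerBoundO.isDiscreteValuationRing_unitBall p E
  haveI := LambdaLowerBoundO.isAdicComplete_maximalIdeal_unitBall p E
  haveI : IsFractionRing (PadicIntermediateField.unitBall p E) E :=
    IsIntegralClosure.isFractionRing_of_finite_extension ℤ_[p] ℚ_[p] E (PadicIntermediateField.unitBall p E)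
  obtain ⟨ϖ, hϖ⟩ := IsDiscreteValuationRing.exists_irreducible (PadicIntermediateField.unitBall p E)
  rw [lambdaInvariant_eq_mul_finrank_baseChange_unitBall p E M hℤM hΛM, lambdaInvariant_eq_mul_finrank_baseChange_unitBall p E N hℤN hΛN]
  exact Nat.mul_le_mul_left _ (CharIdealLambda.finrank_baseChange_le_of_lengthAt_le E hϖ N M hN hM fun 𝔭 _ _ ↦
    Module.lengthAt_le_of_surjective g hg 𝔭)

/-- **`λ` increases along injections**, carrier `𝒪⟦T⟧`: for f.g. torsion `Λ_𝒪`-modules `M ↪ N` with compatible structures,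
`lambdaInvariant p M ≤ lambdaInvariant p N`. [cite: Washington1997, §13.2] -/
theorem lambdaInvariant_le_of_injective (M : Type v) (N : Type v') [AddCommGroup M] [AddCommGroup N]
    [Module (PowerSeries (PadicIntermediateField.unitBall p E)) M] [Module (PowerSeries (PadicIntermediateField.unitBall p E)) N]
    [Module.Finite (PowerSeries (PadicIntermediateField.unitBall p E)) M] [Module.Finite (PowerSeries (PadicIntermediateField.unitBall p E)) N]
    (hM : Module.IsTorsion (PowerSeries (PadicIntermediateField.unitBall p E)) M)
    (hN : Module.IsTorsion (PowerSeries (PadicIntermediateField.unitBall p E)) N)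
    [Module (PadicIntermediateField.unitBall p E) M] [Module (PadicIntermediateField.unitBall p E) N]
    (h𝒪M : ∀ (a : PadicIntermediateField.unitBall p E) (m : M), (PowerSeries.C a) • m = a • m)
    (h𝒪N : ∀ (a : PadicIntermediateField.unitBall p E) (n : N), (PowerSeries.C a) • n = a • n)
    [Module ℤ_[p] M] [Module ℤ_[p] N]
    (hℤM : ∀ (r : ℤ_[p]) (m : M), (algebraMap ℤ_[p] (PadicIntermediateField.unitBall p E) r) • m = r • m)
    (hℤN : ∀ (r : ℤ_[p]) (n : N), (algebraMap ℤ_[p] (PadicIntermediateField.unitBall p E) r) • n = r • n)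
    [Module (IwasawaAlgebra p) M] [Module (IwasawaAlgebra p) N]
    (hΛM : ∀ (r : ℤ_[p]) (m : M), (PowerSeries.C r : IwasawaAlgebra p) • m = r • m)
    (hΛN : ∀ (r : ℤ_[p]) (n : N), (PowerSeries.C r : IwasawaAlgebra p) • n = r • n)
    (g : M →ₗ[PowerSeries (PadicIntermediateField.unitBall p E)] N) (hg : Function.Injective g) :
    lambdaInvariant p M ≤ lambdaInvariant p N := by
  haveI : IsScalarTower (PadicIntermediateField.unitBall p E) (PowerSeries (PadicIntermediateField.unitBall p E)) M :=
    IsScalarTower.of_algebraMap_smul h𝒪M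
  haveI : IsScalarTower (PadicIntermediateField.unitBall p E) (PowerSeries (PadicIntermediateField.unitBall p E)) N :=
    IsScalarTower.of_algebraMap_smul h𝒪N
  haveI := LambdaLowerBoundO.isDiscreteValuationRing_unitBall p E
  haveI := LambdaLowerBoundO.isAdicComplete_maximalIdeal_unitBall p E
  haveI : IsFractionRing (PadicIntermediateField.unitBall p E) E :=
    IsIntegralClosure.isFractionRing_of_finite_extension ℤ_[p] ℚ_[p] E (PadicIntermediateField.unitBall p E)
  obtain ⟨ϖ, hϖ⟩ := IsDiscreteValuationRing.exists_irreducible (PadicIntermediateField.unitBall p E)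
  rw [lambdaInvariant_eq_mul_finrank_baseChange_unitBall p E M hℤM hΛM, lambdaInvariant_eq_mul_finrank_baseChange_unitBall p E N hℤN hΛN]
  exact Nat.mul_le_mul_left _ (CharIdealLambda.finrank_baseChange_le_of_lengthAt_le E hϖ M N hM hN fun 𝔭 _ _ ↦
    Module.lengthAt_le_of_injective g hg 𝔭)

end UnitBall

section CoeffIntegers

variable (p : ℕ) [Fact p.Prime] (S : Set (PadicAlgCl p)) [FiniteDimensional ℚ_[p] (padicCoeffField S)]

/-- **`λ` decreases along surjections on `IwasawaAlgebraO S`, pinned form** (`ι₀ : ℤ_p → 𝒪` compatible with `ℚ̄_p`; `Λ`-structures pinned by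
`(C r)•m = (C (ι₀ r))•m`). [cite: Washington1997, §13.2] -/
theorem lambdaInvariant_le_of_surjective_iwasawaAlgebraO :
    ∀ (ι₀ : ℤ_[p] →+* padicCoeffIntegers S),
      (∀ x : ℤ_[p], ((ι₀ x : padicCoeffIntegers S) : PadicAlgCl p) = algebraMap ℚ_[p] (PadicAlgCl p) (x : ℚ_[p])) →
    ∀ (M N : Type v) [AddCommGroup M] [AddCommGroup N] [Module (IwasawaAlgebraO S) M] [Module (IwasawaAlgebraO S) N]
      [Module.Finite (IwasawaAlgebraO S) M] [Module.Finite (IwasawaAlgebraO S) N]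
      [Module (IwasawaAlgebra p) M] [Module (IwasawaAlgebra p) N],
      Module.IsTorsion (IwasawaAlgebraO S) M → Module.IsTorsion (IwasawaAlgebraO S) N →
      (∀ (r : ℤ_[p]) (m : M), (PowerSeries.C r : IwasawaAlgebra p) • m = (PowerSeries.C (ι₀ r) : IwasawaAlgebraO S) • m) →
      (∀ (r : ℤ_[p]) (n : N), (PowerSeries.C r : IwasawaAlgebra p) • n = (PowerSeries.C (ι₀ r) : IwasawaAlgebraO S) • n) →
    ∀ (g : M →ₗ[IwasawaAlgebraO S] N),
      Function.Surjective g → lambdaInvariant p N ≤ lambdaInvariant p M := by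
  unfold IwasawaAlgebraO
  rw [padicCoeffIntegers_eq_unitBall S]
  intro ι₀ hι₀ M N _ _ _ _ _ _ _ _ hM hN hΛM hΛN g hg
  -- `ι₀` is the structure map
  have hι : ι₀ = algebraMap ℤ_[p] (PadicIntermediateField.unitBall p (padicCoeffField S)) := by
    refine RingHom.ext fun x ↦ Subtype.ext ?_
    rw [hι₀ x]
    change algebraMap ℚ_[p] (PadicAlgCl p) (x : ℚ_[p]) = algebraMap ℤ_[p] (PadicAlgCl p) x
    rw [IsScalarTower.algebraMap_apply ℤ_[p] ℚ_[p] (PadicAlgCl p), PadicInt.algebraMap_apply]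
  subst hι
  letI mOM : Module (PadicIntermediateField.unitBall p (padicCoeffField S)) M :=
    Module.compHom M (PowerSeries.C : PadicIntermediateField.unitBall p (padicCoeffField S) →+* _)
  letI mON : Module (PadicIntermediateField.unitBall p (padicCoeffField S)) N :=
    Module.compHom N (PowerSeries.C : PadicIntermediateField.unitBall p (padicCoeffField S) →+* _)
  letI mZM : Module ℤ_[p] M := Module.compHom M
    ((PowerSeries.C : PadicIntermediateField.unitBall p (padicCoeffField S) →+* _).comp
      (algebraMap ℤ_[p] (PadicIntermediateField.unitBall p (padicCoeffField S))))
  letI mZN : Module ℤ_[p] N := Module.compHom N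
    ((PowerSeries.C : PadicIntermediateField.unitBall p (padicCoeffField S) →+* _).comp
      (algebraMap ℤ_[p] (PadicIntermediateField.unitBall p (padicCoeffField S))))
  exact lambdaInvariant_le_of_surjective p (padicCoeffField S) M N hM hN (fun _ _ ↦ rfl) (fun _ _ ↦ rfl)
    (fun _ _ ↦ rfl) (fun _ _ ↦ rfl) (fun r m ↦ hΛM r m) (fun r n ↦ hΛN r n) g hg

/-- **`λ` increases along injections on `IwasawaAlgebraO S`, pinned form.** [cite: Washington1997, §13.2] -/
theorem lambdaInvariant_le_of_injective_iwasawaAlgebraO :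
    ∀ (ι₀ : ℤ_[p] →+* padicCoeffIntegers S),
      (∀ x : ℤ_[p], ((ι₀ x : padicCoeffIntegers S) : PadicAlgCl p) = algebraMap ℚ_[p] (PadicAlgCl p) (x : ℚ_[p])) →
    ∀ (M N : Type v) [AddCommGroup M] [AddCommGroup N] [Module (IwasawaAlgebraO S) M] [Module (IwasawaAlgebraO S) N]
      [Module.Finite (IwasawaAlgebraO S) M] [Module.Finite (IwasawaAlgebraO S) N]
      [Module (IwasawaAlgebra p) M] [Module (IwasawaAlgebra p) N],
      Module.IsTorsion (IwasawaAlgebraO S) M → Module.IsTorsion (IwasawaAlgebraO S) N →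
      (∀ (r : ℤ_[p]) (m : M), (PowerSeries.C r : IwasawaAlgebra p) • m = (PowerSeries.C (ι₀ r) : IwasawaAlgebraO S) • m) →
      (∀ (r : ℤ_[p]) (n : N), (PowerSeries.C r : IwasawaAlgebra p) • n = (PowerSeries.C (ι₀ r) : IwasawaAlgebraO S) • n) →
    ∀ (g : M →ₗ[IwasawaAlgebraO S] N),
      Function.Injective g → lambdaInvariant p M ≤ lambdaInvariant p N := by
  unfold IwasawaAlgebraO
  rw [padicCoeffIntegers_eq_unitBall S]
  intro ι₀ hι₀ M N _ _ _ _ _ _ _ _ hM hN hΛM hΛN g hg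
  -- `ι₀` is the structure map
  have hι : ι₀ = algebraMap ℤ_[p] (PadicIntermediateField.unitBall p (padicCoeffField S)) := by
    refine RingHom.ext fun x ↦ Subtype.ext ?_
    rw [hι₀ x]
    change algebraMap ℚ_[p] (PadicAlgCl p) (x : ℚ_[p]) = algebraMap ℤ_[p] (PadicAlgCl p) x
    rw [IsScalarTower.algebraMap_apply ℤ_[p] ℚ_[p] (PadicAlgCl p), PadicInt.algebraMap_apply]
  subst hι
  letI mOM : Module (PadicIntermediateField.unitBall p (padicCoeffField S)) M :=
    Module.compHom M (PowerSeries.C : PadicIntermediateField.unitBall p (padicCoeffField S) →+* _)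
  letI mON : Module (PadicIntermediateField.unitBall p (padicCoeffField S)) N :=
    Module.compHom N (PowerSeries.C : PadicIntermediateField.unitBall p (padicCoeffField S) →+* _)
  letI mZM : Module ℤ_[p] M := Module.compHom M
    ((PowerSeries.C : PadicIntermediateField.unitBall p (padicCoeffField S) →+* _).comp
      (algebraMap ℤ_[p] (PadicIntermediateField.unitBall p (padicCoeffField S))))
  letI mZN : Module ℤ_[p] N := Module.compHom N
    ((PowerSeries.C : PadicIntermediateField.unitBall p (padicCoeffField S) →+* _).comp
      (algebraMap ℤ_[p] (PadicIntermediateField.unitBall p (padicCoeffField S))))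
  exact lambdaInvariant_le_of_injective p (padicCoeffField S) M N hM hN (fun _ _ ↦ rfl) (fun _ _ ↦ rfl)
    (fun _ _ ↦ rfl) (fun _ _ ↦ rfl) (fun r m ↦ hΛM r m) (fun r n ↦ hΛN r n) g hg

/-- ★★ **`λ` decreases along surjections in the glue's context** (`[Algebra Λ Λ_𝒪]`, `halg`, `[IsScalarTower Λ Λ_𝒪 ·]`): for f.g. torsion
`Λ_𝒪`-modules and a surjective `Λ_𝒪`-linear `g : M → N`, `lambdaInvariant p N ≤ lambdaInvariant p M`. [cite: Washington1997, §13.2] -/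
theorem lambdaInvariant_le_of_surjective_of_algebraMap_eq [Algebra (IwasawaAlgebra p) (IwasawaAlgebraO S)]
    (halg : ∀ r : IwasawaAlgebra p, algebraMap (IwasawaAlgebra p) (IwasawaAlgebraO S) r = iwasawaToIwasawaO S r)
    (M N : Type v) [AddCommGroup M] [AddCommGroup N] [Module (IwasawaAlgebraO S) M] [Module (IwasawaAlgebraO S) N]
    [Module.Finite (IwasawaAlgebraO S) M] [Module.Finite (IwasawaAlgebraO S) N]
    [Module (IwasawaAlgebra p) M] [Module (IwasawaAlgebra p) N]
    [IsScalarTower (IwasawaAlgebra p) (IwasawaAlgebraO S) M] [IsScalarTower (IwasawaAlgebra p) (IwasawaAlgebraO S) N]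
    (hM : Module.IsTorsion (IwasawaAlgebraO S) M) (hN : Module.IsTorsion (IwasawaAlgebraO S) N)
    (g : M →ₗ[IwasawaAlgebraO S] N) (hg : Function.Surjective g) :
    lambdaInvariant p N ≤ lambdaInvariant p M := by
  have hC : ∀ r : ℤ_[p], algebraMap (IwasawaAlgebra p) (IwasawaAlgebraO S) (PowerSeries.C r) =
      PowerSeries.C (padicIntToCoeffIntegers S r) := fun r ↦ by
    rw [halg]; unfold iwasawaToIwasawaO; rw [PowerSeries.map_C]
  refine lambdaInvariant_le_of_surjective_iwasawaAlgebraO p S (padicIntToCoeffIntegers S)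
    (coe_padicIntToCoeffIntegers S) M N hM hN (fun r m ↦ ?_) (fun r n ↦ ?_) g hg
  · rw [← IsScalarTower.algebraMap_smul (IwasawaAlgebraO S) (PowerSeries.C r : IwasawaAlgebra p) m, hC]
  · rw [← IsScalarTower.algebraMap_smul (IwasawaAlgebraO S) (PowerSeries.C r : IwasawaAlgebra p) n, hC]

/-- ★★ **`λ` increases along injections in the glue's context**: for f.g. torsion `Λ_𝒪`-modules and an injective `Λ_𝒪`-linear `g : M → N`,
`lambdaInvariant p M ≤ lambdaInvariant p N`. [cite: Washington1997, §13.2] -/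
theorem lambdaInvariant_le_of_injective_of_algebraMap_eq [Algebra (IwasawaAlgebra p) (IwasawaAlgebraO S)]
    (halg : ∀ r : IwasawaAlgebra p, algebraMap (IwasawaAlgebra p) (IwasawaAlgebraO S) r = iwasawaToIwasawaO S r)
    (M N : Type v) [AddCommGroup M] [AddCommGroup N] [Module (IwasawaAlgebraO S) M] [Module (IwasawaAlgebraO S) N]
    [Module.Finite (IwasawaAlgebraO S) M] [Module.Finite (IwasawaAlgebraO S) N]
    [Module (IwasawaAlgebra p) M] [Module (IwasawaAlgebra p) N]
    [IsScalarTower (IwasawaAlgebra p) (IwasawaAlgebraO S) M] [IsScalarTower (IwasawaAlgebra p) (IwasawaAlgebraO S) N]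
    (hM : Module.IsTorsion (IwasawaAlgebraO S) M) (hN : Module.IsTorsion (IwasawaAlgebraO S) N)
    (g : M →ₗ[IwasawaAlgebraO S] N) (hg : Function.Injective g) :
    lambdaInvariant p M ≤ lambdaInvariant p N := by
  have hC : ∀ r : ℤ_[p], algebraMap (IwasawaAlgebra p) (IwasawaAlgebraO S) (PowerSeries.C r) =
      PowerSeries.C (padicIntToCoeffIntegers S r) := fun r ↦ by
    rw [halg]; unfold iwasawaToIwasawaO; rw [PowerSeries.map_C]
  refine lambdaInvariant_le_of_injective_iwasawaAlgebraO p S (padicIntToCoeffIntegers S)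
    (coe_padicIntToCoeffIntegers S) M N hM hN (fun r m ↦ ?_) (fun r n ↦ ?_) g hg
  · rw [← IsScalarTower.algebraMap_smul (IwasawaAlgebraO S) (PowerSeries.C r : IwasawaAlgebra p) m, hC]
  · rw [← IsScalarTower.algebraMap_smul (IwasawaAlgebraO S) (PowerSeries.C r : IwasawaAlgebra p) n, hC]

end CoeffIntegers

end Summit.BirchSwinnertonDyer.BirchSwinnertonDyer.Theorems.SmallImageRttE2Num

end
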